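import Summits.QuantumFields.YangMills.Theorems.SoloInformedU1Helicity
import Mathlib.Analysis.Normed.Group.Tannery
import HarnessLib
import HarnessLib.Audit.Tags

/-!
# QuantumFields / YangMills — helicity gap ⇒ Wilson `U(1)₄` masslessness (solo seat `solo-QuantumFields-informed`, s18)

**What this is.** The reduction announced in `SoloInformedU1Helicity.lean` (`K1` infrastructure for the abelian
comparison theory; NOT a step towards `YangMills`): the open conjecture
`Literature.Barriers.QuantumFields.AbelianMasslessPhaseD4` (no exponentially clustering infinite-volume limit state
of Wilson `U(1)₄` at large `β`; printed only for the Villain action, Fröhlich–Spencer 1982 §2.11) follows from a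
single stiffness inequality on the electric-flux box variances, `U1HelicityGapD4`.

**What is proved** (no facts, no axioms beyond the standard ones, no `sorry`):
* `boxVar_eq`: `∫ (∑_{x ∈ B_N} sin θ_{(x;0,1)})² dμ = ∑_z overlap_N(z) G_μ(z;0,1)` for summable `G_μ(·;0,1)`,
  `overlap_N(z) = #{x ∈ B_N : x + z ∈ B_N}`, `B_N = [-N,N]⁴`;
* `tendsto_overlap_div`, `tendsto_boxVar_div`: the Følner property `overlap_N(z)/#B_N → 1` and, by dominated
  convergence for series, `Var_μ(∑_{B_N} sin θ)/#B_N → ∑_z G_μ(z;0,1)`;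
* `abelianMasslessPhaseD4_of_u1HelicityGapD4 : U1HelicityGapD4 → AbelianMasslessPhaseD4`: a clustering limit
  state has summable `G`'s (`summable_plaqCorr_of_clustering`), hence obeys the susceptibility sum rule
  `β ∑_z G(z;0,1) = ⟨cos θ_p⟩` (`beta_mul_tsum_plaqCorr`), hence `β Var_μ(∑_{B_N} sin θ)/#B_N → ⟨cos θ_p⟩`,
  contradicting the gap `≤ ⟨cos θ_p⟩ − δ`.

**Status of the hypothesis.** `U1HelicityGapD4` is tagged `@[conjecture]`: it is the expected large-`β`
behaviour (free-photon value `β Var/#B_N → 1/2 < 1 ← ⟨cos θ_p⟩`; Guth 1980, Fröhlich–Spencer 1982 p. 433 with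
fn. 3 p. 435) and is not proved here or in print for the Wilson action; at strong coupling it is false (clustering
holds there, `osterwalder_seiler_strongCoupling`, and the theorem above then forces equality in the sum rule). The
value of the reduction is that it replaces "no clustering state exists" by a one-sided variance bound on a
single explicit local observable, uniform in the volume — the form in which renormalisation-group or
infrared-bound arguments deliver masslessness.
-/

noncomputable section

open MeasureTheory Filter Topology ProbabilityTheory Finset
open Literature.Probability.LatticeModels hiding configShift configShift_apply
open Literature.MathematicalPhysics.QuantumLattice
open Literature.MathematicalPhysics.QuantumFieldTheory hiding IsLocalObservable Site ZdEdge
open Literature.MathematicalPhysics.QuantumFieldTheory.AreaLaw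
open Literature.Barriers.QuantumFields

namespace Summit.QuantumFields.YangMills.Theorems

namespace U1Helicity

variable {β : ℝ} {μ : Measure (LGConfig 4 Circle)}

/-! ### Box variances of the electric flux and their Følner limit -/

/-- The number of sites `x ∈ B_N` with `x + z ∈ B_N` (`B_N = box 4 N = [-N, N]⁴`). -/
def overlap (N : ℕ) (z : Literature.Probability.LatticeModels.Site 4) : ℕ :=
  #((box 4 N).filter fun x => x + z ∈ box 4 N)

/-- `overlap_N(z) ≤ #B_N`. -/
theorem overlap_le (N : ℕ) (z : Literature.Probability.LatticeModels.Site 4) :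
    overlap N z ≤ #(box 4 N) :=
  Finset.card_filter_le _ _

/-- For `z ∈ B_K` and `K ≤ N`, every `x ∈ B_{N-K}` has `x, x + z ∈ B_N`: `#B_{N−K} ≤ overlap_N(z)`. -/
theorem card_box_sub_le_overlap {K N : ℕ} (hK : K ≤ N)
    {z : Literature.Probability.LatticeModels.Site 4} (hz : z ∈ box 4 K) :
    #(box 4 (N - K)) ≤ overlap N z := by
  refine Finset.card_le_card fun x hx => ?_
  simp only [Finset.mem_filter, mem_box, Pi.add_apply] at hz hx ⊢
  push_cast [Nat.cast_sub hK] at hx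
  have hK0 : (0 : ℤ) ≤ K := Nat.cast_nonneg _
  exact ⟨fun i => ⟨by linarith [(hx i).1], by linarith [(hx i).2]⟩,
    fun i => ⟨by linarith [(hx i).1, (hz i).1], by linarith [(hx i).2, (hz i).2]⟩⟩

/-- **Box variance identity.** `Var_μ(∑_{x ∈ B_N} sin θ_{(x;0,1)}) = ∑_z overlap_N(z) G_μ(z;0,1)`
(translation invariance; `G` summable). -/
theorem boxVar_eq (hμ : μ ∈ infiniteVolumeLimitPoints (d := 4) u1Rep β)
    (hD : Summable fun y => plaqCorr μ y 0 1) (N : ℕ) :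
    ∫ U, (∑ x ∈ box 4 N, u1PlaqIm x 0 1 U) ^ 2 ∂μ = ∑' z, (overlap N z : ℝ) * plaqCorr μ z 0 1 := by
  classical
  have hprob : IsProbabilityMeasure μ := by obtain ⟨_, _, h, _⟩ := hμ; exact h
  have hint : ∀ x y : Literature.Probability.LatticeModels.Site 4,
      Integrable (fun U => u1PlaqIm x 0 1 U * u1PlaqIm y 0 1 U) μ := fun x y =>
    integrable_of_continuous ((continuous_u1PlaqIm _ _ _).mul (continuous_u1PlaqIm _ _ _))
      (C := 1) fun U => by
        rw [abs_mul]
        exact mul_le_one₀ (abs_u1PlaqIm_le _ _ _ _) (abs_nonneg _) (abs_u1PlaqIm_le _ _ _ _)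
  -- expand the square and integrate termwise
  have h1 : ∫ U, (∑ x ∈ box 4 N, u1PlaqIm x 0 1 U) ^ 2 ∂μ
      = ∑ x ∈ box 4 N, ∑ y ∈ box 4 N, plaqCorr μ (y - x) 0 1 := by
    simp only [sq, Finset.sum_mul_sum]
    rw [integral_finsetSum _ (fun x _ => integrable_finsetSum _ fun y _ => hint x y)]
    refine Finset.sum_congr rfl fun x _ => ?_
    rw [integral_finsetSum _ (fun y _ => hint x y)]
    exact Finset.sum_congr rfl fun y _ => integral_u1PlaqIm_mul hμ x y 0 1
  -- rewrite each inner sum as a sum over the difference variable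
  have h2 : ∀ x : Literature.Probability.LatticeModels.Site 4, ∑ y ∈ box 4 N, plaqCorr μ (y - x) 0 1
      = ∑' z, if x + z ∈ box 4 N then plaqCorr μ z 0 1 else 0 := by
    intro x
    rw [tsum_eq_sum (s := (box 4 N).image fun y => y - x) (fun z hz => by
      simp only [Finset.mem_image, not_exists, not_and] at hz
      split_ifs with h
      · exact absurd (add_sub_cancel_left x z) (hz (x + z) h)
      · rfl)]
    rw [Finset.sum_image fun y _ y' _ h => sub_left_injective h]
    refine Finset.sum_congr rfl fun y hy => ?_
    rw [add_sub_cancel, if_pos hy]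
  have h3 : ∀ x ∈ box 4 N, Summable fun z : Literature.Probability.LatticeModels.Site 4 =>
      if x + z ∈ box 4 N then plaqCorr μ z 0 1 else 0 := fun x _ =>
    Summable.of_norm_bounded hD.abs fun z => by
      split_ifs <;> simp
  rw [h1, Finset.sum_congr rfl fun x _ => h2 x, ← Summable.tsum_finsetSum h3]
  refine tsum_congr fun z => ?_
  rw [← Finset.sum_filter, Finset.sum_const, nsmul_eq_mul, overlap]

/-- **Følner property of the boxes:** `overlap_N(z) / #B_N → 1` for every fixed `z`. -/
theorem tendsto_overlap_div (z : Literature.Probability.LatticeModels.Site 4) :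
    Tendsto (fun N : ℕ => (overlap N z : ℝ) / #(box 4 N)) atTop (𝓝 1) := by
  set K : ℕ := Finset.univ.sup fun i => (z i).natAbs with hK
  have hz : z ∈ box 4 K := mem_box_sup z
  have hg : Tendsto (fun N : ℕ => (1 - (2 * K : ℝ) / (2 * N + 1)) ^ 4) atTop (𝓝 1) := by
    have h1 : Tendsto (fun N : ℕ => (2 * (N : ℝ) + 1)) atTop atTop :=
      tendsto_atTop_mono (fun N => by linarith [(N.cast_nonneg : (0 : ℝ) ≤ N)])
        tendsto_natCast_atTop_atTop
    have h2 : Tendsto (fun N : ℕ => (2 * K : ℝ) / (2 * N + 1)) atTop (𝓝 0) :=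
      tendsto_const_nhds.div_atTop h1
    simpa using ((tendsto_const_nhds (x := (1 : ℝ))).sub h2).pow 4
  refine tendsto_of_tendsto_of_tendsto_of_le_of_le' hg tendsto_const_nhds ?_ ?_
  · filter_upwards [eventually_ge_atTop K] with N hN
    have hpos : (0 : ℝ) < 2 * N + 1 := by positivity
    have hc : ((#(box 4 (N - K)) : ℕ) : ℝ) ≤ overlap N z := by
      exact_mod_cast card_box_sub_le_overlap hN hz
    rw [card_box] at hc ⊢
    push_cast [Nat.cast_sub hN] at hc ⊢
    rw [le_div_iff₀ (by positivity)]
    calc (1 - 2 * (K : ℝ) / (2 * N + 1)) ^ 4 * (2 * (N : ℝ) + 1) ^ 4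
        = (2 * ((N : ℝ) - K) + 1) ^ 4 := by
          rw [← mul_pow, sub_mul, div_mul_cancel₀ _ hpos.ne', one_mul]; ring
      _ ≤ (overlap N z : ℝ) := hc
  · filter_upwards with N
    exact div_le_one_of_le₀ (by exact_mod_cast overlap_le N z) (by positivity)

/-- **Følner limit of the box variances:** `Var_μ(∑_{x ∈ B_N} sin θ_{(x;0,1)}) / #B_N → ∑_z G_μ(z;0,1)`
(dominated convergence for series, `G` summable). -/
theorem tendsto_boxVar_div (hμ : μ ∈ infiniteVolumeLimitPoints (d := 4) u1Rep β)
    (hD : Summable fun y => plaqCorr μ y 0 1) :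
    Tendsto (fun N : ℕ => (∫ U, (∑ x ∈ box 4 N, u1PlaqIm x 0 1 U) ^ 2 ∂μ) / #(box 4 N)) atTop
      (𝓝 (∑' z, plaqCorr μ z 0 1)) := by
  have h : Tendsto (fun N : ℕ => ∑' z, (overlap N z : ℝ) / #(box 4 N) * plaqCorr μ z 0 1) atTop
      (𝓝 (∑' z, 1 * plaqCorr μ z 0 1)) := by
    refine tendsto_tsum_of_dominated_convergence (bound := fun z => |plaqCorr μ z 0 1|) hD.abs
      (fun z => (tendsto_overlap_div z).mul_const _) ?_
    filter_upwards with N z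
    rw [Real.norm_eq_abs, abs_mul]
    refine mul_le_of_le_one_left (abs_nonneg _) ?_
    rw [abs_of_nonneg (by positivity)]
    exact div_le_one_of_le₀ (by exact_mod_cast overlap_le N z) (by positivity)
  simp only [one_mul] at h
  refine Tendsto.congr (fun N => ?_) h
  rw [boxVar_eq hμ hD N, ← tsum_div_const]
  exact tsum_congr fun z => by ring

end U1Helicity

open U1Helicity

/-- **The helicity-gap (stiffness) hypothesis for Wilson `U(1)₄`.** There is `β₁` such that for
every `β > β₁` and every infinite-volume limit state `μ ∈ infiniteVolumeLimitPoints (d := 4) u1Rep β`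
the electric-flux box variances are eventually strictly below their Gauss-law (sum-rule) value:
`∃ δ > 0, ∃ N₀, ∀ N ≥ N₀, β · Var_μ(∑_{x ∈ B_N} sin θ_{(x;0,1)}) ≤ (⟨cos θ_p⟩_μ − δ) · #B_N`.
In physical terms `δ` is a positive renormalised photon stiffness (helicity modulus): in the free
photon (spin-wave) approximation `β · Var/#B_N → 1/2` while `⟨cos θ_p⟩ → 1`. This is the expected
large-`β` behaviour (Guth 1980, Fröhlich–Spencer 1982) and is NOT proved here or in print for the
Wilson action; it fails at strong coupling, where clustering forces equality (`beta_mul_tsum_plaqCorr`). -/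
@[conjecture] def U1HelicityGapD4 : Prop :=
  ∃ β₁ : ℝ, ∀ β : ℝ, β₁ < β → ∀ μ ∈ infiniteVolumeLimitPoints (d := 4) u1Rep β,
    ∃ δ : ℝ, 0 < δ ∧ ∃ N₀ : ℕ, ∀ N : ℕ, N₀ ≤ N →
      β * ∫ U, (∑ x ∈ box 4 N, u1PlaqIm x 0 1 U) ^ 2 ∂μ ≤
        ((∫ U, ((ZdGaugeConfig.plaquette U 0 0 1 : Circle) : ℂ).re ∂μ) - δ) * #(box 4 N)

/-- **Helicity gap ⇒ Wilson `U(1)₄` masslessness.** If the electric-flux box variances stay a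
definite amount below the Gauss-law value (`U1HelicityGapD4`), then no infinite-volume limit state
at `β > β₁` clusters exponentially (`AbelianMasslessPhaseD4`): exponential clustering would make the
electric two-plaquette functions summable, the Gauss-law Ward identities then force the
susceptibility sum rule `β ∑_z G(z;0,1) = ⟨cos θ_p⟩`, and the Følner limit of the box variances
recovers `∑_z G(z;0,1)` — contradicting the gap. -/
theorem abelianMasslessPhaseD4_of_u1HelicityGapD4 (h : U1HelicityGapD4) :
    AbelianMasslessPhaseD4 := by
  obtain ⟨β₁, hβ⟩ := h
  refine ⟨β₁, fun β hβ1 μ hμ => ?_⟩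
  rintro ⟨m, hcl⟩
  obtain ⟨δ, hδ, N₀, hgap⟩ := hβ β hβ1 μ hμ
  have h01 := summable_plaqCorr_of_clustering hμ hcl 0 1
  have h12 := summable_plaqCorr_of_clustering hμ hcl 1 2
  have h13 := summable_plaqCorr_of_clustering hμ hcl 1 3
  have hsr := beta_mul_tsum_plaqCorr hμ h01 h12 h13
  have hlim := (tendsto_boxVar_div hμ h01).const_mul β
  rw [hsr] at hlim
  have hle : meanPlaq μ ≤ meanPlaq μ - δ := by
    refine le_of_tendsto hlim ?_
    filter_upwards [eventually_ge_atTop N₀] with N hN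
    have hpos : (0 : ℝ) < #(box 4 N) := by exact_mod_cast (box_nonempty 4 N).card_pos
    rw [← mul_div_assoc, div_le_iff₀ hpos]
    exact hgap N hN
  linarith

end Summit.QuantumFields.YangMills.Theorems
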